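import Summits.Ventures.PercRepro.GenQTraceProfileE
import Summits.Ventures.PercRepro.GenQFlatLatticeA

/-!
# PercRepro — the flat-lattice counting rows, part B: the `j`-subsets of the hyperplane traces by rank (night-4, gen 11)

For a rank-`(q − 1)` flat `H` with a spanning `s`-point trace, the `j`-subsets of `H ∩ G` are of rank `q − 1` (the
spanning ones, `spF`) or of rank `ρ ≤ q − 2`, and the latter lie in the rank-`ρ` flats inside `H` with spanning traces
(`choose_eq_sum_card_rank_subsets` and `h2_row` applied to the trace; `flatsTr_inter_subset`).  Summing over the
traces and counting the inside pairs by the flat (`sum_nrInM_le`, the cap (T8)):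

`Σ_s C(s, j)·h_s ≤ Σ_s SP_{s,j} + Σ_{ρ ≤ q−2} Σ_{s′} C(n − s′, q − 1 − ρ)·C(s′, j)·h^{(ρ)}_{s′}`

— the row (G-B) of the two-level profile LP (sheet §65 (b)) (`gb_row`).  Imports `GenQTraceProfileE`, `GenQFlatLatticeA`.
-/
namespace PercRepro.Night4

open Finset ThmH SixFour GenQ PerFlat Star

variable {α : Type*} [DecidableEq α] {M : Matroid α} [M.Finite]

/-- A flat with a spanning trace on `H ∩ G` (`H` a flat) lies inside `H`, and its trace on `H ∩ G` is its trace on `G`: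
`flatsTr M (H ∩ G) ρ s′ ⊆ {F ∈ flatsTr M G ρ s′ : F ⊆ H}`. -/
theorem flatsTr_inter_subset {G H : Finset α} {q ρ s' : ℕ} (hH : H ∈ flatsQ M q) :
    flatsTr M (H ∩ G) ρ s' ⊆ (flatsTr M G ρ s').filter (fun F : Finset α => F ⊆ H) := by
  intro F hF
  rw [mem_flatsTr] at hF
  obtain ⟨hFq, hFs, hFr⟩ := hF
  have hFH : F ⊆ H := by
    -- `F ∩ (H ∩ G)` spans `F`, so `F = cl(F ∩ (H ∩ G)) ⊆ cl(H) = H`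
    have hcl : (F : Set α) = M.closure ((F ∩ (H ∩ G) : Finset α) : Set α) :=
      coe_eq_closure_inter_of_spanning hFq hFr
    have hsub : M.closure ((F ∩ (H ∩ G) : Finset α) : Set α) ⊆ M.closure (H : Set α) :=
      M.closure_subset_closure (Finset.coe_subset.2 (Finset.inter_subset_right.trans Finset.inter_subset_left))
    rw [(mem_flatsQ.1 hH).2.1.closure] at hsub
    rw [← Finset.coe_subset, hcl]
    exact hsub
  have hFG : F ∩ (H ∩ G) = F ∩ G := by
    ext x
    simp only [Finset.mem_inter]
    constructor
    · rintro ⟨hxF, _, hxG⟩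
      exact ⟨hxF, hxG⟩
    · rintro ⟨hxF, hxG⟩
      exact ⟨hxF, hFH hxF, hxG⟩
  rw [Finset.mem_filter, mem_flatsTr]
  refine ⟨⟨hFq, ?_, ?_⟩, hFH⟩
  · rw [← hFG]
    exact hFs
  · rw [← hFG]
    exact hFr

/-- `spF` on the trace `H ∩ G` of a flat `F ⊆ H` is `spF` on `G`: `F ∩ (H ∩ G) = F ∩ G`. -/
theorem spF_inter_eq {G H F : Finset α} (hFH : F ⊆ H) (r j : ℕ) :
    spF M (H ∩ G) F r j = spF M G F r j := by
  unfold spF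
  have hFG : F ∩ (H ∩ G) = F ∩ G := by
    ext x
    simp only [Finset.mem_inter]
    constructor
    · rintro ⟨hxF, _, hxG⟩
      exact ⟨hxF, hxG⟩
    · rintro ⟨hxF, hxG⟩
      exact ⟨hxF, hFH hxF, hxG⟩
  rw [hFG]

/-- The rank-`ρ` `j`-subsets of a trace `H ∩ G` (`ρ ≤ q − 2`, `H` a rank-`(q−1)` flat) are at most
`Σ_{s′} C(s′, j)·#{F ∈ flatsTr M G ρ s′ : F ⊆ H}`. -/
theorem card_rank_subsets_inter_le {G H : Finset α} {q ρ : ℕ} (hG : G ⊆ gr M) (hH : H ∈ flatsQ M (q - 1)) (j : ℕ) :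
    (((H ∩ G).powersetCard j).filter (fun T : Finset α => M.eRk (T : Set α) = (ρ : ℕ∞))).card
      ≤ ∑ s' ∈ Finset.range (G.card + 1), s'.choose j * ((flatsTr M G ρ s').filter (fun F : Finset α => F ⊆ H)).card := by
  classical
  rw [h2_row (Finset.inter_subset_right.trans hG) ρ j]
  -- the sum over the trace sizes of `H ∩ G` vs of `G`: the sizes of `H ∩ G` are at most `|G|`
  have hrange : ∑ s' ∈ Finset.range ((H ∩ G).card + 1), spSum M (H ∩ G) ρ s' j
      = ∑ s' ∈ Finset.range (G.card + 1), spSum M (H ∩ G) ρ s' j := by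
    refine Finset.sum_subset (fun s' hs' => ?_) (fun s' _ hs' => ?_)
    · rw [Finset.mem_range] at hs' ⊢
      have := Finset.card_le_card (Finset.inter_subset_right (s₁ := H) (s₂ := G))
      omega
    · rw [Finset.mem_range] at hs'
      unfold spSum
      refine Finset.sum_eq_zero (fun F hF => ?_)
      exfalso
      have h := (mem_flatsTr.1 hF).2.1
      have := Finset.card_le_card (Finset.inter_subset_right (s₁ := F) (s₂ := H ∩ G))
      omega
  rw [hrange]
  refine Finset.sum_le_sum (fun s' _ => ?_)
  unfold spSum
  calc ∑ F ∈ flatsTr M (H ∩ G) ρ s', spF M (H ∩ G) F ρ j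
      ≤ ∑ F ∈ (flatsTr M G ρ s').filter (fun F : Finset α => F ⊆ H), spF M (H ∩ G) F ρ j :=
        Finset.sum_le_sum_of_subset (flatsTr_inter_subset hH)
    _ ≤ ∑ F ∈ (flatsTr M G ρ s').filter (fun F : Finset α => F ⊆ H), s'.choose j := by
        refine Finset.sum_le_sum (fun F hF => ?_)
        rw [Finset.mem_filter] at hF
        rw [spF_inter_eq hF.2]
        unfold spF
        calc (((F ∩ G).powersetCard j).filter (fun T : Finset α => M.eRk (T : Set α) = (ρ : ℕ∞))).card
            ≤ ((F ∩ G).powersetCard j).card := Finset.card_filter_le _ _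
          _ = s'.choose j := by rw [Finset.card_powersetCard, (mem_flatsTr.1 hF.1).2.1]
    _ = s'.choose j * ((flatsTr M G ρ s').filter (fun F : Finset α => F ⊆ H)).card := by
        rw [Finset.sum_const, smul_eq_mul, mul_comm]

/-- **(G-B)**: `Σ_s C(s, j)·h_s ≤ Σ_s SP_{s,j} + Σ_{ρ ≤ q−2} Σ_{s′} C(n − s′, q − 1 − ρ)·C(s′, j)·h^{(ρ)}_{s′}`
(`2 ≤ q`). -/
theorem gb_row {G : Finset α} {q : ℕ} (hG : G ⊆ gr M) (hq : 2 ≤ q) (j : ℕ) :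
    ∑ s ∈ Finset.range (G.card + 1), s.choose j * hypTr M G (q - 1) s
      ≤ ∑ s ∈ Finset.range (G.card + 1), spSum M G (q - 1) s j
        + ∑ ρ ∈ Finset.range (q - 1), ∑ s' ∈ Finset.range (G.card + 1),
            (G.card - s').choose (q - 1 - ρ) * (s'.choose j * hypTr M G ρ s') := by
  classical
  -- per trace: `C(s, j) = spF + Σ_{ρ ≤ q−2} #{rank-ρ j-subsets of H ∩ G}`
  have hper : ∀ s ∈ Finset.range (G.card + 1), ∀ H ∈ flatsTr M G (q - 1) s,
      s.choose j ≤ spF M G H (q - 1) j + ∑ ρ ∈ Finset.range (q - 1),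
        ∑ s' ∈ Finset.range (G.card + 1), s'.choose j * ((flatsTr M G ρ s').filter (fun F : Finset α => F ⊆ H)).card := by
    intro s _ H hH
    have hH' := mem_flatsTr.1 hH
    have hsplit := choose_eq_sum_card_rank_subsets (M := M) (G := H ∩ G) (q := q - 1) hH'.2.2 j
    rw [hH'.2.1] at hsplit
    have h1 : q - 1 + 1 = (q - 2) + 1 + 1 := by omega
    rw [h1, Finset.sum_range_succ] at hsplit
    have h2 : ((q - 2 + 1 : ℕ) : ℕ∞) = ((q - 1 : ℕ) : ℕ∞) := by
      have : q - 2 + 1 = q - 1 := by omega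
      rw [this]
    rw [h2] at hsplit
    have hq1 : q - 1 = q - 2 + 1 := by omega
    rw [hsplit, hq1, add_comm]
    refine Nat.add_le_add_left ?_ _
    refine Finset.sum_le_sum (fun ρ _ => ?_)
    exact card_rank_subsets_inter_le hG hH'.1 j
  -- sum over the traces of each size
  have hsum : ∑ s ∈ Finset.range (G.card + 1), s.choose j * hypTr M G (q - 1) s
      ≤ ∑ s ∈ Finset.range (G.card + 1), ∑ H ∈ flatsTr M G (q - 1) s, (spF M G H (q - 1) j
          + ∑ ρ ∈ Finset.range (q - 1), ∑ s' ∈ Finset.range (G.card + 1),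
              s'.choose j * ((flatsTr M G ρ s').filter (fun F : Finset α => F ⊆ H)).card) := by
    refine Finset.sum_le_sum (fun s hs => ?_)
    unfold hypTr
    rw [Finset.card_eq_sum_ones, Finset.mul_sum, mul_one]
    exact Finset.sum_le_sum (fun H hH => hper s hs H hH)
  refine hsum.trans ?_
  simp only [Finset.sum_add_distrib]
  refine Nat.add_le_add (le_of_eq ?_) ?_
  · rfl
  -- the lower flats: swap to count by `(ρ, s′)` and apply the cap (T8)
  have hswap : ∑ s ∈ Finset.range (G.card + 1), ∑ H ∈ flatsTr M G (q - 1) s, ∑ ρ ∈ Finset.range (q - 1),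
        ∑ s' ∈ Finset.range (G.card + 1), s'.choose j * ((flatsTr M G ρ s').filter (fun F : Finset α => F ⊆ H)).card
      = ∑ ρ ∈ Finset.range (q - 1), ∑ s' ∈ Finset.range (G.card + 1), s'.choose j *
          ∑ s ∈ Finset.range (G.card + 1), nrInM M G q s ρ s' := by
    unfold nrInM
    simp only [Finset.mul_sum]
    calc ∑ s ∈ Finset.range (G.card + 1), ∑ H ∈ flatsTr M G (q - 1) s, ∑ ρ ∈ Finset.range (q - 1),
          ∑ s' ∈ Finset.range (G.card + 1), s'.choose j * ((flatsTr M G ρ s').filter (fun F : Finset α => F ⊆ H)).card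
        = ∑ s ∈ Finset.range (G.card + 1), ∑ ρ ∈ Finset.range (q - 1), ∑ s' ∈ Finset.range (G.card + 1),
            ∑ H ∈ flatsTr M G (q - 1) s, s'.choose j * ((flatsTr M G ρ s').filter (fun F : Finset α => F ⊆ H)).card := by
          refine Finset.sum_congr rfl (fun s _ => ?_)
          rw [Finset.sum_comm]
          exact Finset.sum_congr rfl (fun ρ _ => Finset.sum_comm)
      _ = ∑ ρ ∈ Finset.range (q - 1), ∑ s' ∈ Finset.range (G.card + 1), ∑ s ∈ Finset.range (G.card + 1),
            ∑ H ∈ flatsTr M G (q - 1) s, s'.choose j * ((flatsTr M G ρ s').filter (fun F : Finset α => F ⊆ H)).card := by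
          rw [Finset.sum_comm]
          exact Finset.sum_congr rfl (fun ρ _ => Finset.sum_comm)
  rw [hswap]
  refine Finset.sum_le_sum (fun ρ _ => Finset.sum_le_sum (fun s' _ => ?_))
  rw [mul_left_comm]
  exact Nat.mul_le_mul_left _ (sum_nrInM_le hG q ρ s')

end PercRepro.Night4
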